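import Summits.QuantumFields.YangMills.Theorems.ComplexCouplingChannelComplexStrongCouplingAnchor
import Summits.QuantumFields.YangMills.Theorems.ComplexCouplingChannelFreeEnergyWindowChannelStubChainOnCompacts
import Summits.QuantumFields.YangMills.Theorems.ComplexCouplingChannelFreeEnergyWindowChannelStubWindowOnCompacts
import Summits.QuantumFields.YangMills.Theorems.ComplexCouplingChannelFreeEnergyWindowChannelStubConnectedCompactJoin
import Summits.QuantumFields.YangMills.Theorems.ComplexCouplingChannelFreeEnergyWindowChannelStubLocalWindowOfEnvelope
import Summits.QuantumFields.YangMills.Theorems.ComplexCouplingChannelFreeEnergyWindowChannelStubBeadSlide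
import Summits.QuantumFields.YangMills.Theorems.ComplexCouplingChannelFreeEnergyWindowChannelStubLandingChannel
import Summits.QuantumFields.YangMills.Theorems.ComplexCouplingChannelFreeEnergyWindowChannelStubEnvelopeCriterion
import Literature.MathematicalPhysics.QuantumFieldTheory.WilsonFinTorusPartitionComplex

/-!
# Line `Sketch` (idea `upper-envelope-suffices`) for crux `FreeEnergyWindowChannel` (stmt-QuantumFields-18842)

Lead skeleton (prover-line-stmt-QuantumFields-18842-0, 2026-08-17; v7 — criterion LANDED p151472: every group-blind declaration of the line is now a tree theorem; the skeleton's only sorries are the three PHYSICS stubs `stub_envelope` (C⁺⁺ ≡ crux), `stub_reachEnvelope`, `stub_localEnvelope`; v6 — the equivalence crux ⇔ C⁺⁺ and E ⇒ crux packaged as the registered stub `stub_envelopeCriterion` (proved, landing as a Theorems file); v5 — all SIX group-blind stubs landed, only the three physics stubs `stub_envelope` (C⁺⁺ ≡ crux), `stub_reachEnvelope`, `stub_localEnvelope` remain; v4 — wave 2: S5 `stub_localWindowOfEnvelope` p149462 and S6b `stub_beadSlide` p148595 LANDED; S6a `stub_landingChannel` RESHAPED with the hypothesis `0 ≤ βs`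 (the v3 form was false for `βs ∈ (−r₀, −r₀/2]`, witness `βs = −3/5, r₀ = 1, D = ball βs 1`, worker ad8174911).)

The crux (route `ComplexCouplingChannel`, rank 3): for every compact simple `G` and faithful unitary `r`,
beyond some `β₁`, every real coupling `β ≥ β₁` is joined to the strong-coupling anchor by an open connected
complex-coupling channel `D` on which the symmetric-torus Wilson partition functions
`Z_P(z) = wilsonFinTorusPartitionC r.ρ z P P P P` (`P ≥ P₀`) are zero-free with a BOUNDED continuation of
the finite-size free energy, `|log ‖Z_P z‖ + P⁴ Re f z| ≤ M`, one analytic `f` on `D`.  (The crux's inline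
`let Zc := …` is `fun z a t => wilsonFinTorusPartitionC r.ρ z a a a t` by `rfl`.)

THE LINE (v4).  The crux is EQUIVALENT (both directions proved in this file, `FreeEnergyWindowChannel_of` and
`envelopeFloor_of_crux`) to the ONE-SIDED statement C⁺⁺ = `stub_envelope`: same binders as the crux, conclusion =
the FLOOR `log ‖Z_P x‖ + P⁴ Re f x ≥ −M` at the single real point `x` plus the ENVELOPE
`‖Z_P(z) · exp (P⁴ f z)‖ ≤ e^M` on `D` (`P ≥ P₀`) — no zero-freeness, no two-sided bound.  C⁺⁺ ⇒ crux: the LOCAL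
converter `stub_localWindowOfEnvelope` (LANDED p149462: floor at the centre + envelope on a ball ⇒ zero-free
two-sided window on a smaller ball, Schwarz bound + Borel–Carathéodory) pins `f` near `x`; the GLOBAL converter
(LANDED: `stub_chainOnCompacts` p146686, `stub_windowOnCompacts` p146776 — two-constants along disc chains against
the envelope, fed by the PROVED anchor `complexStrongCouplingAnchor_proof`) gives the zero-free window with `M = 1`
on every compact `K ⊆ D`; `stub_connectedCompactJoin` (LANDED p146690) supplies an open connected `D' ∋ x, β` inside
such a `K`.  The PURE ENVELOPE statement E (channel through `0`, `f 0 = 0`, envelope only; `envelope_of_regime`'s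
conclusion) implies C⁺⁺ with `x := 0`, where the floor is free (`Z_P 0 = 1`): `windowAt_of_envelope`.

REGIME FORM (optional second layer, `envelope_of_regime`, PROVED below modulo stubs): E (hence C⁺⁺, hence the
crux: `FreeEnergyWindowChannel_of_regime`) follows from
`stub_reachEnvelope` (physics, global: an envelope channel from `0` landing on a disc at SOME `βs ≥ b`, for every
`b`, disciplined: nothing to the right of `Re z = βs` except the landing disc) and `stub_localEnvelope` (physics,
weak coupling, local: at every large real `t` an envelope on a complex ball around `t` plus the FLOOR at the
single real point `t` — the reflection-positivity content), via `stub_localWindowOfEnvelope` (local windows),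
`stub_landingChannel` (plane topology: a compactly contained sub-channel with a clean landing zone) and
`stub_beadSlide` (bead chain along `[βs, β]`, patching the analytic `f`'s up to imaginary constants on convex
overlaps).  The physics stubs E / reach / local are open-problem grade (volume-uniform complex-coupling control
of 4D non-abelian lattice gauge theory at weak coupling); everything else is group-blind one-variable analysis.

History: v1 (4 stubs: upperEnvelope, chainOnCompacts, windowOnCompacts, connectedCompactJoin; 06:52Z);
v2 = v1 with S2–S4 landed (`Lines/Sketch_v2_upperEnvelope.lean`); v3 = this file (pinning clause of C⁺ removed
via the free floor at `0`; regime layer added).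
Disproof used (Cruxes/…/Disproof.lean, cdisprove cycles 1–2; v2 read 10:25Z: S2–S4 "pass the degenerate-case reading",
S3 also provable by Montel without the chain hypothesis, "all weight is on S1 = C⁺, crux-equivalent given the anchor",
and the witness-rigidity lemmas `Negative/WitnessRigidity.lean` p146945 — `Re f(Re z) ≤ Re f(z)`: the envelope needs
the cancellations `e^{-P⁴(Re f(x+iy) − Re f(x))}`, it cannot come from `‖Z(z)‖ ≤ Z(Re z)`; no Targets against this
line's stubs); cycle 1: §1 `windowAt_small_coupling` (the window holds on the
anchor disc — consistent with E at `β` small), §2 `re_nonneg_of_window` / `norm_Z_le_one` (necessary conditions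
any envelope `f` meets: `Re f ≥ 0` on `D ∩ {0 ≤ Re z}`), §3 mutations (drop simplicity ⇒ U(1) massless phase,
`log P` growth — sits inside E / localEnvelope, where `IsCompactSimpleLieGroup` is available).  No `-- Targets`.
-/

open MeasureTheory Complex Metric Set

namespace Summit.QuantumFields.YangMills.Cruxes.FreeEnergyWindowChannel.Sketch

/-! ## Layer 1: the envelope-with-floor statement (≡ crux), the pure envelope statement E, the converters -/

/-- STUB C⁺⁺ (physics; difficulty: open-problem) — registered under the name `stub_envelope`.  ENVELOPE WITH A FLOOR
AT THE ANCHOR POINT: the crux's binders (`β ≥ β₁`, `ρ > 0`, an open connected `D ∋ β`, a real `x ∈ D` with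
`|x| < ρ`, a holomorphic `f` on `D`, `M`, `P₀`) with the conclusion replaced by: the FLOOR at the single real point
`x`, `log ‖Z_P x‖ + P⁴ Re f x ≥ −M`, and the ENVELOPE `‖Z_P(z) · exp (P⁴ f z)‖ ≤ e^M` on `D`, for all `P ≥ P₀`.
No zero-freeness, no two-sided bound.  EQUIVALENT to the crux: `envelopeFloor_of_crux` (trivial direction) and
`FreeEnergyWindowChannel_of` (via the local converter at `x`, the landed global converter and the proved anchor),
both proved in this file.  Implied by the pure envelope statement E (channel through `0`, `f 0 = 0`: `x := 0`, where
the floor is free because `Z_P 0 = 1`; `windowAt_of_envelope`). -/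
theorem stub_envelope :
    ∀ (G : Type) [Group G] [TopologicalSpace G] [IsTopologicalGroup G] [CompactSpace G] [MeasurableSpace G] [BorelSpace G], Literature.MathematicalPhysics.QuantumFieldTheory.IsCompactSimpleLieGroup G → ∀ r : Literature.MathematicalPhysics.QuantumFieldTheory.LatticeRep G,
    ∃ β₁ : ℝ, ∀ β : ℝ, β₁ ≤ β → ∀ ρ : ℝ, 0 < ρ →
      ∃ D : Set ℂ, IsOpen D ∧ IsConnected D ∧ (β : ℂ) ∈ D ∧
        ∃ x : ℝ, |x| < ρ ∧ (x : ℂ) ∈ D ∧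
        ∃ f : ℂ → ℂ, DifferentiableOn ℂ f D ∧ ∃ M : ℝ, ∃ P₀ : ℕ,
          (∀ P : ℕ, P₀ ≤ P →
            -M ≤ Real.log ‖Literature.MathematicalPhysics.QuantumFieldTheory.wilsonFinTorusPartitionC r.ρ (x : ℂ) P P P P‖ +
              (P : ℝ) ^ 4 * (f (x : ℂ)).re) ∧
          ∀ P : ℕ, P₀ ≤ P → ∀ z ∈ D,
            ‖Literature.MathematicalPhysics.QuantumFieldTheory.wilsonFinTorusPartitionC r.ρ z P P P P *
              Complex.exp ((P : ℂ) ^ 4 * f z)‖ ≤ Real.exp M := by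
  sorry

/-! S5 `stub_localWindowOfEnvelope` LANDED (p149462, `Theorems/…StubLocalWindowOfEnvelope.lean`) and S6b `stub_beadSlide`
LANDED (p148595, `Theorems/…StubBeadSlide.lean`), namespace `Summit.QuantumFields.YangMills.Theorems.FreeEnergyWindowChannel`;
imported above and used by name below. -/

/-! CRITERION `stub_envelopeCriterion : (crux ↔ C⁺⁺) ∧ (E → crux)` LANDED (p151472,
`Theorems/…StubEnvelopeCriterion.lean`, with `windowAt_of_envelopeFloor`, `envelopeFloor_of_crux`, `windowAt_of_envelope`),
namespace `Summit.QuantumFields.YangMills.Theorems.FreeEnergyWindowChannel`; imported above and used by name below. -/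

/-- COMPOSITION: the crux BY NAME from `stub_envelope` (C⁺⁺) through the criterion. -/
theorem FreeEnergyWindowChannel_of :
    Summit.QuantumFields.YangMills.Theses.ComplexCouplingChannel.FreeEnergyWindowChannel :=
  Summit.QuantumFields.YangMills.Theorems.FreeEnergyWindowChannel.stub_envelopeCriterion.1.2 stub_envelope

/-! ## Layer 2 (optional): E from a disciplined reach + local envelopes (regime form) -/

/-! S6a `stub_landingChannel` LANDED (p150777, `Theorems/…StubLandingChannel.lean`, corrected signature with `0 ≤ βs`;
the v3 form was false for `βs ∈ (−r₀, −r₀/2]`, witness `βs = −3/5, r₀ = 1, D = ball βs 1, z = 0`). -/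

/-- STUB R (physics; global; the non-abelian input; difficulty: open-problem).  REACH, one-sided: for every
threshold `b` there are `βs ≥ b`, `r₀ > 0`, an open connected `D ∋ 0` with `ball βs r₀ ⊆ D` and
`D ⊆ {Re z < βs} ∪ ball βs r₀` (the channel may skirt bulk first-order lines through `ℂ` but arrives at `βs` as
a clean disc), a holomorphic `f` on `D` with `f 0 = 0`, and `M, P₀` with the ENVELOPE
`‖Z_P(z) · exp (P⁴ f z)‖ ≤ e^M` on `D` for `P ≥ P₀`.  One-sided weakening of the tree line regime-cut's
`stub_anchorReachesWeakCoupling`; `U(1)₄`-false in intent (pinch at `β_c`). -/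
theorem stub_reachEnvelope :
    ∀ (G : Type) [Group G] [TopologicalSpace G] [IsTopologicalGroup G] [CompactSpace G] [MeasurableSpace G] [BorelSpace G], Literature.MathematicalPhysics.QuantumFieldTheory.IsCompactSimpleLieGroup G → ∀ r : Literature.MathematicalPhysics.QuantumFieldTheory.LatticeRep G,
    ∀ b : ℝ, ∃ βs : ℝ, b ≤ βs ∧ ∃ r₀ : ℝ, 0 < r₀ ∧ ∃ D : Set ℂ, IsOpen D ∧ IsConnected D ∧ (0 : ℂ) ∈ D ∧
      Metric.ball (βs : ℂ) r₀ ⊆ D ∧ D ⊆ {z : ℂ | z.re < βs} ∪ Metric.ball (βs : ℂ) r₀ ∧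
      ∃ f : ℂ → ℂ, DifferentiableOn ℂ f D ∧ f 0 = 0 ∧ ∃ M : ℝ, ∃ P₀ : ℕ, ∀ P : ℕ, P₀ ≤ P → ∀ z ∈ D,
        ‖Literature.MathematicalPhysics.QuantumFieldTheory.wilsonFinTorusPartitionC r.ρ z P P P P *
          Complex.exp ((P : ℂ) ^ 4 * f z)‖ ≤ Real.exp M := by
  sorry

/-- STUB L (physics; weak coupling; local; difficulty: open-problem).  LOCAL ENVELOPE WITH FLOOR AT THE CENTRE:
beyond some `β₁`, at every real coupling `t ≥ β₁` there are `δ > 0`, a holomorphic `f` on `ball t δ`, `M`, `P₀`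
with, for all `P ≥ P₀`: the FLOOR `log ‖Z_P t‖ + P⁴ Re f t ≥ −M` at the single real point `t` (reflection
positivity: dyadic doubling `Z_{2P} ≤ Z_P^{16}` makes `log Z_P(t) + P⁴ f_∞(t) ≥ 0` once `Re f t = f_∞ t`), and the
ENVELOPE `‖Z_P(z) · exp (P⁴ f z)‖ ≤ e^M` on the ball (volume-uniform complex-coupling control at weak coupling:
the massive-phase content; false in intent for the `U(1)₄` Coulomb phase).  One-sided weakening of the tree line
regime-cut's `stub_cumulantControl` + `stub_windowOfCumulants`. -/
theorem stub_localEnvelope :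
    ∀ (G : Type) [Group G] [TopologicalSpace G] [IsTopologicalGroup G] [CompactSpace G] [MeasurableSpace G] [BorelSpace G], Literature.MathematicalPhysics.QuantumFieldTheory.IsCompactSimpleLieGroup G → ∀ r : Literature.MathematicalPhysics.QuantumFieldTheory.LatticeRep G,
    ∃ β₁ : ℝ, ∀ t : ℝ, β₁ ≤ t → ∃ δ : ℝ, 0 < δ ∧
      ∃ f : ℂ → ℂ, DifferentiableOn ℂ f (Metric.ball (t : ℂ) δ) ∧ ∃ M : ℝ, ∃ P₀ : ℕ,
        (∀ P : ℕ, P₀ ≤ P →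
          -M ≤ Real.log ‖Literature.MathematicalPhysics.QuantumFieldTheory.wilsonFinTorusPartitionC r.ρ (t : ℂ) P P P P‖ +
            (P : ℝ) ^ 4 * (f (t : ℂ)).re) ∧
        ∀ P : ℕ, P₀ ≤ P → ∀ z ∈ Metric.ball (t : ℂ) δ,
          ‖Literature.MathematicalPhysics.QuantumFieldTheory.wilsonFinTorusPartitionC r.ρ z P P P P *
            Complex.exp ((P : ℂ) ^ 4 * f z)‖ ≤ Real.exp M := by
  sorry

/-- REGIME FORM ⇒ E (sorry-free modulo the stubs it names): `β₁(E) := βs`, the landing coupling of the reach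
channel fed with `b := β₁(L)`.  For `β ≥ βs`: pin at `0` (free floor, `stub_localWindowOfEnvelope`), window with
`M = 1` on compacts of the reach channel `D` (landed global converter), clean compactly-contained landing
sub-channel `D₀` (`stub_landingChannel`), local windows at every `t ∈ [βs, β]` (`stub_localEnvelope` +
`stub_localWindowOfEnvelope`, `Z_P(t) > 0` at real `t`), bead slide (`stub_beadSlide`) ⇒ a window `g` on an open
connected `D* ∋ 0, β`; finally `f := g − g 0` is normalised and the envelope constant doubles (the window at
`z = 0`, where `Z_P 0 = 1`, gives `P⁴ Re g 0 ≥ −M'`). -/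
theorem envelope_of_regime :
    ∀ (G : Type) [Group G] [TopologicalSpace G] [IsTopologicalGroup G] [CompactSpace G] [MeasurableSpace G] [BorelSpace G], Literature.MathematicalPhysics.QuantumFieldTheory.IsCompactSimpleLieGroup G → ∀ r : Literature.MathematicalPhysics.QuantumFieldTheory.LatticeRep G,
    ∃ β₁ : ℝ, ∀ β : ℝ, β₁ ≤ β →
      ∃ D : Set ℂ, IsOpen D ∧ IsConnected D ∧ (0 : ℂ) ∈ D ∧ (β : ℂ) ∈ D ∧
        ∃ f : ℂ → ℂ, DifferentiableOn ℂ f D ∧ f 0 = 0 ∧ ∃ M : ℝ, ∃ P₀ : ℕ,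
          ∀ P : ℕ, P₀ ≤ P → ∀ z ∈ D,
            ‖Literature.MathematicalPhysics.QuantumFieldTheory.wilsonFinTorusPartitionC r.ρ z P P P P *
              Complex.exp ((P : ℂ) ^ 4 * f z)‖ ≤ Real.exp M := by
  intro G _ _ _ _ _ _ hG r
  haveI : SecondCountableTopology G :=
    (r.continuous.isClosedEmbedding r.injective).isEmbedding.secondCountableTopology
  set Z : ℕ → ℂ → ℂ := fun P z =>
    Literature.MathematicalPhysics.QuantumFieldTheory.wilsonFinTorusPartitionC r.ρ z P P P P with hZ
  have hZd : ∀ P : ℕ, Differentiable ℂ (Z P) := fun P =>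
    Literature.MathematicalPhysics.QuantumFieldTheory.differentiable_wilsonFinTorusPartitionC r.ρ r.continuous P P P P
  have hZ1 : ∀ P : ℕ, Z P 0 = 1 := fun P =>
    Literature.MathematicalPhysics.QuantumFieldTheory.wilsonFinTorusPartitionC_zero r.ρ P P P P
  have hZpos : ∀ (P : ℕ) (s : ℝ), Z P (s : ℂ) ≠ 0 := fun P s => by
    simp only [hZ, Literature.MathematicalPhysics.QuantumFieldTheory.wilsonFinTorusPartitionC_ofReal, ne_eq,
      Complex.ofReal_eq_zero]
    exact (Literature.MathematicalPhysics.QuantumFieldTheory.wilsonFinTorusPartition_pos r.continuous s P P P P).ne'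
  -- the proved anchor (torus clause)
  obtain ⟨ρ₀, hρ₀, c, hc, -, fA, hfA, C, hA⟩ :=
    Summit.QuantumFields.YangMills.Theorems.complexStrongCouplingAnchor_proof G hG r
  have hA' : ∀ P : ℕ, 1 ≤ P → ∀ z : ℂ, ‖z‖ < ρ₀ → Z P z ≠ 0 ∧
      |Real.log ‖Z P z‖ + (P : ℝ) ^ 4 * (fA z).re| ≤ C * (P : ℝ) ^ 4 * Real.exp (-(c * P)) :=
    fun P hP z hz => hA P hP z hz
  -- the two physics inputs
  obtain ⟨β₁, hloc⟩ := stub_localEnvelope G hG r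
  obtain ⟨βs, hbs, r₀, hr₀, D, hDo, hDc, h0D, hball, hdisc, f, hf, hf0, M, P₀, henv⟩ :=
    stub_reachEnvelope G hG r (max β₁ 0)
  have hβ₁s : β₁ ≤ βs := (le_max_left _ _).trans hbs
  have h0s : 0 ≤ βs := (le_max_right _ _).trans hbs
  have henv' : ∀ P : ℕ, P₀ ≤ P → ∀ z ∈ D, ‖Z P z * Complex.exp ((P : ℂ) ^ 4 * f z)‖ ≤ Real.exp M :=
    fun P hP z hz => henv P hP z hz
  refine ⟨βs, fun β hβ => ?_⟩
  -- pinning at `0` (free floor)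
  obtain ⟨δ₀, hδ₀, hδ₀D⟩ : ∃ δ₀ : ℝ, 0 < δ₀ ∧ Metric.ball (0 : ℂ) δ₀ ⊆ D := Metric.isOpen_iff.1 hDo 0 h0D
  set Mp : ℝ := max M 0 with hMp
  have hfloor : ∀ P : ℕ, P₀ ≤ P → Z P ((0 : ℝ) : ℂ) ≠ 0 ∧
      -Mp ≤ Real.log ‖Z P ((0 : ℝ) : ℂ)‖ + (P : ℝ) ^ 4 * (f ((0 : ℝ) : ℂ)).re := by
    intro P _
    rw [Complex.ofReal_zero, hZ1 P, hf0]
    refine ⟨one_ne_zero, ?_⟩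
    simp only [norm_one, Real.log_one, Complex.zero_re, mul_zero, add_zero, Left.neg_nonpos_iff]
    exact le_max_right _ _
  have henv₀ : ∀ P : ℕ, P₀ ≤ P → ∀ z ∈ Metric.ball ((0 : ℝ) : ℂ) δ₀,
      ‖Z P z * Complex.exp ((P : ℂ) ^ 4 * f z)‖ ≤ Real.exp Mp := by
    intro P hP z hz
    rw [Complex.ofReal_zero] at hz
    exact (henv' P hP z (hδ₀D hz)).trans (Real.exp_le_exp.2 (le_max_left _ _))
  obtain ⟨δ', hδ', hδ'δ, M', hpin⟩ :=
    Summit.QuantumFields.YangMills.Theorems.FreeEnergyWindowChannel.stub_localWindowOfEnvelope Z 0 δ₀ Mp P₀ hδ₀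
    (fun P => (hZd P).differentiableOn) f (by rw [Complex.ofReal_zero]; exact hf.mono hδ₀D) hfloor henv₀
  rw [Complex.ofReal_zero] at hpin
  have hballD : Metric.ball (0 : ℂ) δ' ⊆ D := (Metric.ball_subset_ball hδ'δ).trans hδ₀D
  set M₁ : ℝ := max Mp M' with hM₁
  have hpin₁ : ∃ δ : ℝ, 0 < δ ∧ Metric.ball (0 : ℂ) δ ⊆ D ∧ ∀ P : ℕ, P₀ ≤ P → ∀ z ∈ Metric.ball (0 : ℂ) δ,
      Z P z ≠ 0 ∧ |Real.log ‖Z P z‖ + (P : ℝ) ^ 4 * (f z).re| ≤ M₁ :=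
    ⟨δ', hδ', hballD, fun P hP z hz => ⟨(hpin P hP z hz).1, (hpin P hP z hz).2.trans (le_max_right _ _)⟩⟩
  have henv₁ : ∀ P : ℕ, P₀ ≤ P → ∀ z ∈ D, ‖Z P z * Complex.exp ((P : ℂ) ^ 4 * f z)‖ ≤ Real.exp M₁ :=
    fun P hP z hz => (henv' P hP z hz).trans (Real.exp_le_exp.2 ((le_max_left _ _).trans (le_max_left _ _)))
  have hx0 : ‖(0 : ℂ)‖ < ρ₀ := by simpa using hρ₀
  -- windows on compacts of `D`
  have hK : ∀ K : Set ℂ, IsCompact K → K ⊆ D → ∃ P₁ : ℕ, ∀ P : ℕ, P₁ ≤ P → ∀ z ∈ K,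
      Z P z ≠ 0 ∧ |Real.log ‖Z P z‖ + (P : ℝ) ^ 4 * (f z).re| ≤ 1 := fun K hK hKD =>
    Summit.QuantumFields.YangMills.Theorems.FreeEnergyWindowChannel.stub_windowOnCompacts Z ρ₀ c C hρ₀ hc
      (fun P => (hZd P).differentiableOn) hZ1 fA hfA hA' D hDo hDc (fun P => (hZd P).differentiableOn)
      (0 : ℂ) hx0 h0D
      (fun r hr K' hK' hK'D =>
        Summit.QuantumFields.YangMills.Theorems.FreeEnergyWindowChannel.stub_chainOnCompacts D hDo
          hDc.isPreconnected (0 : ℂ) h0D r hr K' hK' hK'D)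
      f hf M₁ P₀ hpin₁ henv₁ K hK hKD
  -- the clean landing sub-channel and its uniform window
  obtain ⟨D₀, K₀, hD₀o, hD₀c, hK₀, h0D₀, hD₀K₀, hK₀D, hball₀, hclean⟩ :=
    Summit.QuantumFields.YangMills.Theorems.FreeEnergyWindowChannel.stub_landingChannel D hDo hDc h0D βs r₀ hr₀ h0s
      hball hdisc
  obtain ⟨P₁, hP₁⟩ := hK K₀ hK₀ hK₀D
  have hwin₀ : ∀ P : ℕ, P₁ ≤ P → ∀ z ∈ D₀, Z P z ≠ 0 ∧ |Real.log ‖Z P z‖ + (P : ℝ) ^ 4 * (f z).re| ≤ 1 :=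
    fun P hP z hz => hP₁ P hP z (hD₀K₀ hz)
  have hclean' : ∀ z ∈ D₀, βs ≤ z.re → |z.im| < r₀ / 2 / 2 → z ∈ Metric.ball (βs : ℂ) (r₀ / 2) :=
    fun z hz h1 h2 => hclean z hz h1 (by linarith)
  -- local windows along `[βs, β]`
  have hlocal : ∀ x : ℝ, x ∈ Set.Icc βs β → ∃ δ : ℝ, 0 < δ ∧ ∃ g : ℂ → ℂ,
      DifferentiableOn ℂ g (Metric.ball (x : ℂ) δ) ∧ ∃ M' : ℝ, ∃ P₁ : ℕ, ∀ P : ℕ, P₁ ≤ P →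
        ∀ z ∈ Metric.ball (x : ℂ) δ, Z P z ≠ 0 ∧ |Real.log ‖Z P z‖ + (P : ℝ) ^ 4 * (g z).re| ≤ M' := by
    intro x hx
    obtain ⟨δ, hδ, g, hg, Mx, Px, hfl, hev⟩ := hloc x (hβ₁s.trans hx.1)
    obtain ⟨δ'', hδ'', hδ''δ, M'', hw⟩ :=
      Summit.QuantumFields.YangMills.Theorems.FreeEnergyWindowChannel.stub_localWindowOfEnvelope Z x δ Mx Px hδ
      (fun P => (hZd P).differentiableOn) g hg (fun P hP => ⟨hZpos P x, hfl P hP⟩)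
      (fun P hP z hz => hev P hP z hz)
    exact ⟨δ'', hδ'', g, hg.mono (Metric.ball_subset_ball hδ''δ), M'', Px, hw⟩
  -- the slide
  obtain ⟨D', hD'o, hD'c, h0D', hβD', g, hg, M', P₂, hwin'⟩ :=
    Summit.QuantumFields.YangMills.Theorems.FreeEnergyWindowChannel.stub_beadSlide Z βs β (r₀ / 2) hβ (half_pos hr₀)
      D₀ hD₀o hD₀c h0D₀ hball₀ hclean'
      f (hf.mono (hD₀K₀.trans hK₀D)) 1 P₁ hwin₀ hlocal
  -- normalise at `0`
  refine ⟨D', hD'o, hD'c, h0D', hβD', fun z => g z - g 0, hg.sub (differentiableOn_const _), sub_self _,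
    M' + M', P₂, fun P hP z hz => ?_⟩
  obtain ⟨hz0, hzb⟩ := hwin' P hP z hz
  obtain ⟨-, h0b⟩ := hwin' P hP 0 h0D'
  rw [hZ1 P, norm_one, Real.log_one, zero_add] at h0b
  have hre : ((P : ℂ) ^ 4 * (g z - g 0)).re = (P : ℝ) ^ 4 * (g z).re - (P : ℝ) ^ 4 * (g 0).re := by
    rw [show ((P : ℂ) ^ 4) = (((P : ℝ) ^ 4 : ℝ) : ℂ) from by push_cast; ring, Complex.re_ofReal_mul,
      Complex.sub_re, mul_sub]
  rw [norm_mul, Complex.norm_exp, hre, ← Real.log_le_iff_le_exp (by positivity), Real.log_mul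
    (norm_ne_zero_iff.2 hz0) (Real.exp_pos _).ne', Real.log_exp]
  have h1 := (abs_le.1 hzb).2
  have h2 := (abs_le.1 h0b).1
  linarith

/-- SECOND COMPOSITION (sorry-free apart from the stubs it names): the crux BY NAME through the regime layer —
`envelope_of_regime` (stubs `stub_reachEnvelope`, `stub_localEnvelope`, `stub_localWindowOfEnvelope`,
`stub_landingChannel`, `stub_beadSlide` + landed converters) followed by `windowAt_of_envelope`. -/
theorem FreeEnergyWindowChannel_of_regime :
    Summit.QuantumFields.YangMills.Theses.ComplexCouplingChannel.FreeEnergyWindowChannel :=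
  Summit.QuantumFields.YangMills.Theorems.FreeEnergyWindowChannel.stub_envelopeCriterion.2 envelope_of_regime

end Summit.QuantumFields.YangMills.Cruxes.FreeEnergyWindowChannel.Sketch
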